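import Literature.RepresentationTheory.AlgebraicGroups.FirstFundamentalTheoremSLRelative
import Literature.RepresentationTheory.AlgebraicGroups.UnitaryZariskiDense
import HarnessLib

/-!
# Relative `U(N)`-invariants of fewer than `N` vectors are constants

Topic `Literature/RepresentationTheory/AlgebraicGroups`; namespace `Literature.RepresentationTheory.AlgebraicGroups`.
Companion of `FirstFundamentalTheoremSL` / `FirstFundamentalTheoremSLRelative` (left multiplication of `N × N` matrices
on polynomial functions of `N × M` matrices, `leftTranslate g f = f(gX)`, the generic matrix `genericLeftTranslate`,
`evalGen`) and of `UnitaryZariskiDense` (a polynomial in the matrix entries vanishing on `U(N)` vanishes).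

The first fundamental theorem for `SL_N` (Sturmfels 1993, Thm. 3.2.1, proved in `FirstFundamentalTheoremSLProofs`) lists
the invariants of `M ≥ N` vectors; the complementary easy case recorded in `FirstFundamentalTheoremSL`'s docstring — "for
`M < N` there are no non-zero minors and the invariants are the constants" — is PROVED here, in the form the compact
group `U(N)` presents it (relative invariants for a power of `det`):

* **`leftTranslate_eq_of_forall_unitary`** / **`det_pow_mul_leftTranslate_eq_of_forall_unitary`**: an identity
  `f(gX) = det(g)^m · f′(X)` (resp. `det(g)^m · f(gX) = f′(X)`) holding for every UNITARY `g` holds for every complex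
  matrix `g` (Zariski density of `U(N)`, through the generic ring `ℂ[x][t]`: `genRing_eq_zero_of_forall_evalGen_unitary`);
* **`eq_C_of_forall_unitary_leftTranslate_eq`**: `f(gX) = f(X)` for all `g ∈ U(N)` ⟹ `f` is constant (ANY `N, M`: specialise
  the transferred identity at `g = 0`);
* **`eq_zero_of_forall_unitary_det_pow_mul_leftTranslate_eq`**: `det(g)^m f(gX) = f(X)` on `U(N)` with `m ≥ 1`, `N ≥ 1` ⟹ `f = 0`;
* **`eq_zero_of_forall_unitary_leftTranslate_eq_det_pow_mul`**: `f(gX) = det(g)^m f(X)` on `U(N)` with `m ≥ 1` and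
  `M < N` ⟹ `f = 0` (through a SINGULAR matrix fixing the `M < N` columns of a point, `exists_det_eq_zero_forall_mulVec_col_eq`).

Use (pub-hodgecm model cell, rows A12/A34, field `dense` at the places of kind `D₁₂`: `U(V_b) = U(3)` compact acting on
the Fock polynomials in `3 × 2` variables through a power of `det` — the isotypic polynomials are the constants or zero).

References: [GoodmanWallachGTM255] R. Goodman, N. R. Wallach, *Symmetry, Representations, and Invariants*, §5.2.1;
[Sturmfels1993] B. Sturmfels, *Algorithms in Invariant Theory*, §3.2 (remark after Thm. 3.2.1); H. Weyl, *The Classical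
Groups*, II §6 and VIII §11 (unitarian trick).  Everything below is proved from Mathlib + the tree; no cited fact is assumed.
Provenance: LEAN-IN-TREE rule (2026-08-18), pub-hodgecm model-construction sub-cell, seat mc-binder-2 gen 7; KERNEL only.
-/

noncomputable section

open scoped BigOperators

namespace Literature.RepresentationTheory.AlgebraicGroups

open MvPolynomial

variable {N M : ℕ}

/-! ## 1. Unitary Zariski density in the generic ring -/

/-- **Zariski density of `U(N)` in the generic ring**: a polynomial in the generic matrix `t` with coefficients in
`ℂ[x]` killed by every unitary specialisation `t := g` is zero. [cite: GoodmanWallachGTM255, Thm 11.5.10] [folklore] -/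
theorem genRing_eq_zero_of_forall_evalGen_unitary {D : GenRing N M}
    (h : ∀ g : Matrix (Fin N) (Fin N) ℂ, g ∈ Matrix.unitaryGroup (Fin N) ℂ → evalGen g D = 0) : D = 0 := by
  refine MvPolynomial.ext _ _ fun β => ?_
  rw [coeff_zero]
  refine MvPolynomial.funext fun ξ => ?_
  rw [map_zero]
  have hmap : MvPolynomial.map (eval ξ) D = 0 :=
    mvPolynomial_eq_zero_of_eval_unitaryGroup _ fun U hU => by
      have h1 := congrArg (eval ξ) (h U hU)
      rw [map_zero, eval_evalGen] at h1
      exact h1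
  have h2 := congrArg (coeff β) hmap
  rwa [coeff_map, coeff_zero] at h2

/-- `evalGen g` fixes the coefficient ring `ℂ[x]`. [folklore] -/
theorem evalGen_C (g : Matrix (Fin N) (Fin N) ℂ) (f : MvPolynomial (Fin N × Fin M) ℂ) :
    evalGen (M := M) g (C f) = f :=
  (evalGen (M := M) g).commutes f

/-- **Transfer from `U(N)` to all matrices, covariant form**: if `f(gX) = det(g)^m · f′(X)` for every unitary `g`
then for every complex matrix `g`. [cite: GoodmanWallachGTM255, §3.3.4] [folklore] -/
theorem leftTranslate_eq_of_forall_unitary {f f' : MvPolynomial (Fin N × Fin M) ℂ} {m : ℕ}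
    (h : ∀ g : Matrix (Fin N) (Fin N) ℂ, g ∈ Matrix.unitaryGroup (Fin N) ℂ → leftTranslate g f = C (g.det ^ m) * f')
    (g : Matrix (Fin N) (Fin N) ℂ) : leftTranslate g f = C (g.det ^ m) * f' := by
  have hD : genericLeftTranslate N M f - (Matrix.mvPolynomialX (Fin N) (Fin N) _).det ^ m * C f' = 0 :=
    genRing_eq_zero_of_forall_evalGen_unitary fun U hU => by
      rw [map_sub, map_mul, map_pow, evalGen_genericLeftTranslate, evalGen_det, evalGen_C, h U hU, ← map_pow, sub_self]
  have hg := congrArg (evalGen g) hD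
  rwa [map_sub, map_zero, map_mul, map_pow, evalGen_genericLeftTranslate, evalGen_det, evalGen_C, ← map_pow,
    sub_eq_zero] at hg

/-- **Transfer from `U(N)` to all matrices, contravariant form**: if `det(g)^m · f(gX) = f′(X)` for every unitary
`g` then for every complex matrix `g`. [cite: GoodmanWallachGTM255, §3.3.4] [folklore] -/
theorem det_pow_mul_leftTranslate_eq_of_forall_unitary {f f' : MvPolynomial (Fin N × Fin M) ℂ} {m : ℕ}
    (h : ∀ g : Matrix (Fin N) (Fin N) ℂ, g ∈ Matrix.unitaryGroup (Fin N) ℂ → C (g.det ^ m) * leftTranslate g f = f')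
    (g : Matrix (Fin N) (Fin N) ℂ) : C (g.det ^ m) * leftTranslate g f = f' := by
  have hD : (Matrix.mvPolynomialX (Fin N) (Fin N) _).det ^ m * genericLeftTranslate N M f - C f' = 0 :=
    genRing_eq_zero_of_forall_evalGen_unitary fun U hU => by
      rw [map_sub, map_mul, map_pow, evalGen_genericLeftTranslate, evalGen_det, evalGen_C, ← map_pow, h U hU, sub_self]
  have hg := congrArg (evalGen g) hD
  rwa [map_sub, map_zero, map_mul, map_pow, evalGen_genericLeftTranslate, evalGen_det, evalGen_C, ← map_pow,
    sub_eq_zero] at hg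

/-! ## 2. Trivial character: constants; negative relative degree: zero -/

/-- `f(0 · X) = f(0)`: left translation by the zero matrix is the constant term. [folklore] -/
theorem leftTranslate_zero (f : MvPolynomial (Fin N × Fin M) ℂ) :
    leftTranslate (0 : Matrix (Fin N) (Fin N) ℂ) f = C (constantCoeff f) := by
  have h0 : (fun p : Fin N × Fin M => ∑ k : Fin N, C ((0 : Matrix (Fin N) (Fin N) ℂ) p.1 k) * X (k, p.2)) =
      (0 : Fin N × Fin M → MvPolynomial (Fin N × Fin M) ℂ) := by
    funext p
    simp only [Matrix.zero_apply, C_0, zero_mul, Finset.sum_const_zero, Pi.zero_apply]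
  rw [leftTranslate, h0, aeval_zero]
  rfl

/-- **`U(N)`-invariant polynomial functions of `N × M` matrices are constant** (any `N`, `M`): `f(gX) = f(X)` for all
unitary `g` forces `f = f(0)`. [cite: GoodmanWallachGTM255, §5.2.1] [folklore] -/
theorem eq_C_of_forall_unitary_leftTranslate_eq {f : MvPolynomial (Fin N × Fin M) ℂ}
    (h : ∀ g : Matrix (Fin N) (Fin N) ℂ, g ∈ Matrix.unitaryGroup (Fin N) ℂ → leftTranslate g f = f) :
    f = C (constantCoeff f) := by
  have h0 := leftTranslate_eq_of_forall_unitary (m := 0) (f' := f)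
    (fun g hg => by rw [pow_zero, C_1, one_mul]; exact h g hg) 0
  rw [pow_zero, C_1, one_mul, leftTranslate_zero] at h0
  exact h0.symm

/-- **Negative relative degree is impossible**: `det(g)^m · f(gX) = f(X)` on `U(N)` with `m ≥ 1` (i.e. `f(gX) = det(g)^{-m} f(X)`)
and `N ≥ 1` forces `f = 0`. [folklore] -/
theorem eq_zero_of_forall_unitary_det_pow_mul_leftTranslate_eq [NeZero N] {f : MvPolynomial (Fin N × Fin M) ℂ} {m : ℕ}
    (hm : m ≠ 0) (h : ∀ g : Matrix (Fin N) (Fin N) ℂ, g ∈ Matrix.unitaryGroup (Fin N) ℂ → C (g.det ^ m) * leftTranslate g f = f) :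
    f = 0 := by
  have h0 := det_pow_mul_leftTranslate_eq_of_forall_unitary h 0
  rwa [Matrix.det_zero, zero_pow hm, C_0, zero_mul, eq_comm] at h0

/-! ## 3. Positive relative degree with `M < N`: zero -/

/-- Evaluation of a left translate: `(leftTranslate g f)(ξ) = f(gξ)`. [folklore] -/
theorem eval_leftTranslate (g : Matrix (Fin N) (Fin N) ℂ) (f : MvPolynomial (Fin N × Fin M) ℂ) (ξ : Fin N × Fin M → ℂ) :
    eval ξ (leftTranslate g f) = eval (fun p : Fin N × Fin M => ∑ k : Fin N, g p.1 k * ξ (k, p.2)) f := by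
  have hfun : (fun p : Fin N × Fin M => eval ξ (∑ k : Fin N, C (g p.1 k) * X (k, p.2))) =
      fun p => ∑ k : Fin N, g p.1 k * ξ (k, p.2) := by
    funext p
    simp only [map_sum, map_mul, eval_C, eval_X]
  rw [← hfun]
  exact eval₂Hom_bind₁ (RingHom.id ℂ) ξ _ f

/-- **A singular matrix fixing fewer than `N` given vectors**: for `M < N` and any point `ξ` of `N × M` matrices there is
`g` with `det g = 0` and `gξ = ξ` (`g = 1 − v wᵀ` with `wᵀξ = 0`, `wᵀv = 1`). [folklore] -/
theorem exists_det_eq_zero_forall_mulVec_col_eq (hMN : M < N) (ξ : Fin N × Fin M → ℂ) :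
    ∃ g : Matrix (Fin N) (Fin N) ℂ, g.det = 0 ∧ ∀ (k : Fin N) (j : Fin M), ∑ l : Fin N, g k l * ξ (l, j) = ξ (k, j) := by
  let Ξ : Matrix (Fin N) (Fin M) ℂ := fun k j => ξ (k, j)
  have hker : LinearMap.ker (Matrix.vecMulLinear Ξ) ≠ ⊥ :=
    LinearMap.ker_ne_bot_of_finrank_lt (by simpa only [Module.finrank_fin_fun] using hMN)
  obtain ⟨w, hw, hw0⟩ := Submodule.exists_mem_ne_zero_of_ne_bot hker
  rw [LinearMap.mem_ker, Matrix.vecMulLinear_apply] at hw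
  obtain ⟨i, hi⟩ : ∃ i, w i ≠ 0 := Function.ne_iff.mp hw0
  let v : Fin N → ℂ := Pi.single i (w i)⁻¹
  have hwv : w ⬝ᵥ v = 1 := by rw [dotProduct_single, mul_inv_cancel₀ hi]
  have hcol : ∀ j : Fin M, ∑ l : Fin N, w l * ξ (l, j) = 0 := fun j => by
    have := congrFun hw j
    simpa only [Matrix.vecMul, dotProduct, Pi.zero_apply] using this
  refine ⟨1 - Matrix.vecMulVec v w, ?_, fun k j => ?_⟩
  · rw [← Matrix.exists_mulVec_eq_zero_iff]
    refine ⟨v, fun hv => ?_, ?_⟩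
    · have := congrFun hv i
      simp only [v, Pi.single_eq_same, Pi.zero_apply, inv_eq_zero] at this
      exact hi this
    · rw [Matrix.sub_mulVec, Matrix.one_mulVec, Matrix.vecMulVec_mulVec, hwv, MulOpposite.op_one, one_smul, sub_self]
  · simp only [Matrix.sub_apply, Matrix.one_apply, Matrix.vecMulVec_apply, sub_mul, Finset.sum_sub_distrib, ite_mul, one_mul,
      zero_mul, Finset.sum_ite_eq, Finset.mem_univ, if_true, mul_assoc, ← Finset.mul_sum, hcol, mul_zero, sub_zero]

/-- **Relative `U(N)`-invariants of positive degree in `M < N` vectors vanish**: `f(gX) = det(g)^m f(X)` for all unitary `g`,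
`m ≥ 1`, `M < N` ⟹ `f = 0` (transfer to all matrices, then evaluate at a singular `g` fixing the columns of each point).
[cite: Sturmfels1993, §3.2; GoodmanWallachGTM255, §5.2.1] [folklore] -/
theorem eq_zero_of_forall_unitary_leftTranslate_eq_det_pow_mul (hMN : M < N) {f : MvPolynomial (Fin N × Fin M) ℂ} {m : ℕ}
    (hm : m ≠ 0) (h : ∀ g : Matrix (Fin N) (Fin N) ℂ, g ∈ Matrix.unitaryGroup (Fin N) ℂ → leftTranslate g f = C (g.det ^ m) * f) :
    f = 0 := by
  have hall := leftTranslate_eq_of_forall_unitary h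
  refine MvPolynomial.funext fun ξ => ?_
  obtain ⟨g, hg0, hgξ⟩ := exists_det_eq_zero_forall_mulVec_col_eq hMN ξ
  have hev := congrArg (eval ξ) (hall g)
  rw [eval_leftTranslate, map_mul, eval_C, hg0, zero_pow hm, zero_mul] at hev
  have hfix : (fun p : Fin N × Fin M => ∑ k : Fin N, g p.1 k * ξ (k, p.2)) = ξ := funext fun p => hgξ p.1 p.2
  rw [hfix] at hev
  rw [hev, map_zero]

/-- **Summary for a `D₁₂` slot** (`M < N`): a polynomial function of `N × M` matrices on which `U(N)` acts through `det^m`,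
`f(gX) = det(g)^m f(X)`, is the constant `f(0)`, and is `0` unless `m = 0`. [cite: GoodmanWallachGTM255, §5.2.1] [folklore] -/
theorem eq_C_and_eq_zero_of_forall_unitary_leftTranslate_eq_det_pow_mul (hMN : M < N) {f : MvPolynomial (Fin N × Fin M) ℂ}
    {m : ℕ} (h : ∀ g : Matrix (Fin N) (Fin N) ℂ, g ∈ Matrix.unitaryGroup (Fin N) ℂ → leftTranslate g f = C (g.det ^ m) * f) :
    f = C (constantCoeff f) ∧ (m ≠ 0 → f = 0) := by
  by_cases hm : m = 0
  · subst hm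
    exact ⟨eq_C_of_forall_unitary_leftTranslate_eq fun g hg => by rw [h g hg, pow_zero, C_1, one_mul], fun h0 => absurd rfl h0⟩
  · have hf := eq_zero_of_forall_unitary_leftTranslate_eq_det_pow_mul hMN hm h
    refine ⟨?_, fun _ => hf⟩
    rw [hf, map_zero, C_0]

end Literature.RepresentationTheory.AlgebraicGroups

end
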